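import Summits.QuantumFields.BalabanUV.Beta.GAN24.ChargeStepSym

/-!
# `BalabanUV.Beta.GAN24.WilsonQuarticChargeOffDiag` — binder row G-an2-4 / (CONV-C), W-slot road «W3» (SKELETON-W3 v1.0.2 §8.3 ROW W3-F4d ∕
# §8.5 (N-F4d)), sequel of `GAN24/WilsonQuarticCharge` (leaf-18 gen 16) and `GAN24/ChargeStepSym` (gen 17): **THE TWO OFF-DIAGONAL VALUES OF THE
# QUARTIC WILSON CHARGE AT an3's COLOUR-TRACED TABLE `w22 N` — it is NOT bond-symmetric — AND THE RESULTING NO-GO: at `Tc := w22 N`, ROW W3-F2a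
# (m = 0) EXCLUDES ROW W3-F4d's `hZ0` for every `cE₂ ≠ 0`, i.e. for every value of the pin**

NOT IN PRINT; OUR OBSERVATION (journal NOTE l.9613) made a tree theorem (G-an2-4 formalisation swarm, leaf prover `b2b-balaban-gan24-formalise-leaf-18`,
gen 17; [folklore] finite evaluation + composition of tree theorems; module name PROVISIONAL).  HONEST FRAMING (cell contract, verbatim): «discharging
`BetaPertH` makes Bałaban's UV stability UNCONDITIONAL — a real constructive-QFT result; it is NOT the continuum limit and NOT the Clay problem.»  HONEST
DEPENDENCY (verbatim): «continuum YM on T⁴ ⇐ BetaPertH ∧ nine spine estimates (0/9 proved); BetaPertH ⇐ (D1) ∧ (D4) ∧ CAP+tail; G-an2-4 gates asym, D1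
and NE2/3/4.»

WHAT (generic `d`; the no-go needs `1 ≤ d`, `N ≠ 0` colours, `1 ≤ Lc`):
* §1 `frame_eq_zero_of_bg_not_mem` (a plaquette frame `(μ, ν)` sees a bond-direction pattern `(κ, κ′)` only if both are frame directions) and the four
  frame sums of `PlaquetteVertex2Trace.w22 N` for the CROSSED pattern `(κ, κ′; κ′, κ)` (`+N²` per frame) and the PARALLEL pattern `(κ, κ′; κ, κ′)` (`0`),
  `κ ≠ κ′` — the `simp`∕`ring` evaluation of `WilsonQuarticCharge` §3 on the off-diagonal patterns;
* §2 **`tsum_wilsonW₂_w22_ff_cross`** (`Σ'_{u′xz} wilsonW₂ d (w22 N) κ u κ′ u′ x z (inl κ′) (inl κ) = 2N²`), **`tsum_wilsonW₂_w22_ff_par`** (`… (inl κ) (inl κ′) = 0`),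
  `tsum_wilsonW₂_w22_ff_not_bond_symm` — together with §3 of `WilsonQuarticCharge` (`(κ, κ; α, α) ↦ −2N²`) this is leaf-18-g16's exact table
  `Z₄(w22 N) = 2N²(δ_{κβ}δ_{κ′α} − δ_{κκ′}δ_{αβ})` on all its nonzero patterns: symmetric under the SIMULTANEOUS swap `(κ↔κ′, α↔β)`, NOT under `κ↔κ′` alone;
* §3 **`not_hZ0_of_hZb0_w22`** — for an2's normalised Stage-B family at `Tc := w22 N` (`1 ≤ Lc`, binders `hmix`, `hmixt`, colour constants symbolic,
  `cE₂ ≠ 0`): the cell field–field zero mode of the bracket `b 0` vanishing (ROW W3-F2a at `m = 0`, the `zmode` conjunct of the `Zfree` of record) is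
  INCOMPATIBLE with the cell field–field zero mode of the first difference `T♮₁ − T♮₀` vanishing (ROW W3-F4d's `hZ0`) — by
  `ChargeStepSym.quartic_charge_bond_symm_of_hZ0_of_hZb0` the two force a bond-symmetric quartic charge, which §2 refutes at `(0,1;1,0)` vs `(1,0;1,0)`.
CONSEQUENCE (for the row owner; CLAIM RULES (2) ⊥, evidence = this module): as instantiated in SKELETON-W3 §8.3 at `Tc := w22 N`, END #2
`WSlotT2OfPieces.t2Drift_of_rows` has jointly unsatisfiable row hypotheses `hZ` (m = 0) and `hZ0` whenever `cE₂ ≠ 0` — RULINGS-14d's «`hZ0 ⟺ λ = 1`»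
presupposed a scalar action of the linear part on the charge; the action is `λ₀·Sym_{bond}` (`ChargeStepSym.zmode_succ_eq`).  Repairs that keep the road:
(R1) unroll the difference tower from `D₁` (its transported part `𝒜₁ D₀` IS zero-mode-free at `λ₀ = 1`: `Sym ∘ Asym = 0`), (R2) a bond-symmetric member `0`
∕ table of record.  Which `Tc` the D1 identification uses is an2∕an3's call; for a bond-symmetric `Tc` nothing here bites.  Asserts NO shape or rate of
Bałaban's tables; «T2Shape» (END #1) is untouched (no zero mode of `D₀` enters it); discharges NOTHING of «T2Shape» ∕ «T2SupRate» ∕ (hW, hWall); 0 `def`,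
0 cite, 0 `def … : Prop`, 0 sorry, 0 wall binders; NOT «W-slot closed», NEVER «G-an2-4 closed»; NOT BetaPertH, NOT continuum, NOT Clay.
-/

noncomputable section

open Finset
open scoped BigOperators
open Literature.MathematicalPhysics.QuantumFieldTheory
open Literature.MathematicalPhysics.QuantumFieldTheory.Balaban1983to89
open Literature.MathematicalPhysics.QuantumFieldTheory.Balaban1983to89.Beta
open PlaquetteVertex2Stencil (dir)
open PlaquetteVertex2Coords (sgn)
open PlaquetteVertex2Polar (inc qq)
open PlaquetteVertex2Trace (w22 wSym wPair)
open WilsonBiStencil (wilsonW₂)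
open Summit.QuantumFields.BalabanUV.Beta.GAN24.WilsonQuarticCharge (tsum_wilsonW₂_ff_eq dir_eq_or)

namespace Summit.QuantumFields.BalabanUV.Beta.GAN24.WilsonQuarticChargeOffDiag

variable {d : ℕ}

/-! ## §1 Frame sums for the two off-diagonal patterns -/

/-- [folklore] A frame at `(μ, ν)` contributes NOTHING to a pattern with BOND directions `(κ, κ′)` unless both are plaquette directions. -/
theorem frame_eq_zero_of_bg_not_mem (T : Fin 4 → Fin 4 → Fin 4 → Fin 4 → ℝ) {μ ν κ κ' α β : Fin (d + 1)}
    (h : ¬((κ = μ ∨ κ = ν) ∧ (κ' = μ ∨ κ' = ν))) :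
    (∑ k : Fin 4, ∑ l : Fin 4,
        if dir μ ν k = κ ∧ dir μ ν l = κ' then
          ∑ i : Fin 4, ∑ j : Fin 4, (if α = dir μ ν i ∧ β = dir μ ν j then T i j k l else 0)
        else 0) = 0 := by
  refine Finset.sum_eq_zero fun k _ => Finset.sum_eq_zero fun l _ => ?_
  rw [if_neg]
  rintro ⟨hk, hl⟩
  apply h
  refine ⟨?_, ?_⟩
  · rcases dir_eq_or μ ν k with h0 | h0
    · exact Or.inl (hk.symm.trans h0)
    · exact Or.inr (hk.symm.trans h0)
  · rcases dir_eq_or μ ν l with h0 | h0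
    · exact Or.inl (hl.symm.trans h0)
    · exact Or.inr (hl.symm.trans h0)

/-- [folklore] CROSSED pattern `(κ, κ′; κ′, κ)`, frame `(κ, κ′)`: background `k ∈ {0,2}`, `l ∈ {1,3}`, fluctuation `i ∈ {1,3}`, `j ∈ {0,2}`:
the frame sum of `w22 N` is `+N²`. -/
theorem frame_w22_cross₁ (N : ℕ) {κ κ' : Fin (d + 1)} (hκ : κ ≠ κ') :
    (∑ k : Fin 4, ∑ l : Fin 4,
        if dir κ κ' k = κ ∧ dir κ κ' l = κ' then
          ∑ i : Fin 4, ∑ j : Fin 4, (if κ' = dir κ κ' i ∧ κ = dir κ κ' j then w22 N i j k l else 0)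
        else 0) = (N : ℝ) ^ 2 := by
  have hκ' : κ' ≠ κ := fun h => hκ h.symm
  simp only [Fin.sum_univ_four, dir, Matrix.cons_val_zero, Matrix.cons_val_one, Matrix.head_cons, Matrix.cons_val_two,
    Matrix.tail_cons, Matrix.cons_val_three, hκ, hκ', and_true, and_false, if_true, if_false, add_zero, zero_add]
  simp [w22, wSym, wPair, sgn, inc, qq]
  ring

/-- [folklore] CROSSED pattern `(κ, κ′; κ′, κ)`, frame `(κ′, κ)`: background `k ∈ {1,3}`, `l ∈ {0,2}`, fluctuation `i ∈ {0,2}`, `j ∈ {1,3}`: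
`+N²`. -/
theorem frame_w22_cross₂ (N : ℕ) {κ κ' : Fin (d + 1)} (hκ : κ ≠ κ') :
    (∑ k : Fin 4, ∑ l : Fin 4,
        if dir κ' κ k = κ ∧ dir κ' κ l = κ' then
          ∑ i : Fin 4, ∑ j : Fin 4, (if κ' = dir κ' κ i ∧ κ = dir κ' κ j then w22 N i j k l else 0)
        else 0) = (N : ℝ) ^ 2 := by
  have hκ' : κ' ≠ κ := fun h => hκ h.symm
  simp only [Fin.sum_univ_four, dir, Matrix.cons_val_zero, Matrix.cons_val_one, Matrix.head_cons, Matrix.cons_val_two,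
    Matrix.tail_cons, Matrix.cons_val_three, hκ, hκ', and_true, and_false, if_true, if_false, add_zero, zero_add]
  simp [w22, wSym, wPair, sgn, inc, qq]
  ring

/-- [folklore] PARALLEL pattern `(κ, κ′; κ, κ′)`, frame `(κ, κ′)`: background `k ∈ {0,2}`, `l ∈ {1,3}`, fluctuation `i ∈ {0,2}`, `j ∈ {1,3}`: `0`. -/
theorem frame_w22_par₁ (N : ℕ) {κ κ' : Fin (d + 1)} (hκ : κ ≠ κ') :
    (∑ k : Fin 4, ∑ l : Fin 4,
        if dir κ κ' k = κ ∧ dir κ κ' l = κ' then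
          ∑ i : Fin 4, ∑ j : Fin 4, (if κ = dir κ κ' i ∧ κ' = dir κ κ' j then w22 N i j k l else 0)
        else 0) = 0 := by
  have hκ' : κ' ≠ κ := fun h => hκ h.symm
  simp only [Fin.sum_univ_four, dir, Matrix.cons_val_zero, Matrix.cons_val_one, Matrix.head_cons, Matrix.cons_val_two,
    Matrix.tail_cons, Matrix.cons_val_three, hκ, hκ', and_true, and_false, if_true, if_false, add_zero, zero_add]
  simp [w22, wSym, wPair, sgn, inc, qq]
  ring

/-- [folklore] PARALLEL pattern `(κ, κ′; κ, κ′)`, frame `(κ′, κ)`: background `k ∈ {1,3}`, `l ∈ {0,2}`, fluctuation `i ∈ {1,3}`, `j ∈ {0,2}`: `0`. -/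
theorem frame_w22_par₂ (N : ℕ) {κ κ' : Fin (d + 1)} (hκ : κ ≠ κ') :
    (∑ k : Fin 4, ∑ l : Fin 4,
        if dir κ' κ k = κ ∧ dir κ' κ l = κ' then
          ∑ i : Fin 4, ∑ j : Fin 4, (if κ = dir κ' κ i ∧ κ' = dir κ' κ j then w22 N i j k l else 0)
        else 0) = 0 := by
  have hκ' : κ' ≠ κ := fun h => hκ h.symm
  simp only [Fin.sum_univ_four, dir, Matrix.cons_val_zero, Matrix.cons_val_one, Matrix.head_cons, Matrix.cons_val_two,
    Matrix.tail_cons, Matrix.cons_val_three, hκ, hκ', and_true, and_false, if_true, if_false, add_zero, zero_add]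
  simp [w22, wSym, wPair, sgn, inc, qq]
  ring

/-! ## §2 The two off-diagonal values of the quartic Wilson charge at `w22 N` -/

/-- **CROSSED PATTERN: `Σ'_{u′xz} wilsonW₂ d (w22 N) κ u κ′ u′ x z (inl κ′) (inl κ) = 2N²`** for `κ ≠ κ′` [folklore evaluation]: only the frames
`(κ, κ′)` and `(κ′, κ)` contribute, `+N²` each. -/
theorem tsum_wilsonW₂_w22_ff_cross (N : ℕ) {κ κ' : Fin (d + 1)} (hκ : κ ≠ κ') (u : Fin (d + 1) → ℤ) :
    ∑' u' : Fin (d + 1) → ℤ, ∑' x : Fin (d + 1) → ℤ, ∑' z : Fin (d + 1) → ℤ,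
        wilsonW₂ d (w22 N) κ u κ' u' x z (Sum.inl κ') (Sum.inl κ) = 2 * (N : ℝ) ^ 2 := by
  rw [tsum_wilsonW₂_ff_eq]
  rw [← Fintype.sum_prod_type' (f := fun μ ν => ∑ k : Fin 4, ∑ l : Fin 4,
        if dir μ ν k = κ ∧ dir μ ν l = κ' then
          ∑ i : Fin 4, ∑ j : Fin 4, (if κ' = dir μ ν i ∧ κ = dir μ ν j then w22 N i j k l else 0)
        else 0)]
  rw [Finset.sum_eq_add (κ, κ') (κ', κ) (by simpa [Prod.ext_iff] using fun h _ => hκ h)]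
  · rw [frame_w22_cross₁ N hκ, frame_w22_cross₂ N hκ]; ring
  · rintro ⟨μ, ν⟩ - ⟨h1, h2⟩
    refine frame_eq_zero_of_bg_not_mem (w22 N) ?_
    rintro ⟨hκμ | hκν, hκ'μ | hκ'ν⟩
    · exact hκ (hκμ.trans hκ'μ.symm)
    · exact h1 (Prod.ext hκμ.symm hκ'ν.symm)
    · exact h2 (Prod.ext hκ'μ.symm hκν.symm)
    · exact hκ (hκν.trans hκ'ν.symm)
  · exact fun h => absurd (Finset.mem_univ _) h
  · exact fun h => absurd (Finset.mem_univ _) h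

/-- **PARALLEL PATTERN: `Σ'_{u′xz} wilsonW₂ d (w22 N) κ u κ′ u′ x z (inl κ) (inl κ′) = 0`** for `κ ≠ κ′` [folklore evaluation]. -/
theorem tsum_wilsonW₂_w22_ff_par (N : ℕ) {κ κ' : Fin (d + 1)} (hκ : κ ≠ κ') (u : Fin (d + 1) → ℤ) :
    ∑' u' : Fin (d + 1) → ℤ, ∑' x : Fin (d + 1) → ℤ, ∑' z : Fin (d + 1) → ℤ,
        wilsonW₂ d (w22 N) κ u κ' u' x z (Sum.inl κ) (Sum.inl κ') = 0 := by
  rw [tsum_wilsonW₂_ff_eq]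
  rw [← Fintype.sum_prod_type' (f := fun μ ν => ∑ k : Fin 4, ∑ l : Fin 4,
        if dir μ ν k = κ ∧ dir μ ν l = κ' then
          ∑ i : Fin 4, ∑ j : Fin 4, (if κ = dir μ ν i ∧ κ' = dir μ ν j then w22 N i j k l else 0)
        else 0)]
  rw [Finset.sum_eq_add (κ, κ') (κ', κ) (by simpa [Prod.ext_iff] using fun h _ => hκ h)]
  · rw [frame_w22_par₁ N hκ, frame_w22_par₂ N hκ]; ring
  · rintro ⟨μ, ν⟩ - ⟨h1, h2⟩
    refine frame_eq_zero_of_bg_not_mem (w22 N) ?_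
    rintro ⟨hκμ | hκν, hκ'μ | hκ'ν⟩
    · exact hκ (hκμ.trans hκ'μ.symm)
    · exact h1 (Prod.ext hκμ.symm hκ'ν.symm)
    · exact h2 (Prod.ext hκ'μ.symm hκν.symm)
    · exact hκ (hκν.trans hκ'ν.symm)
  · exact fun h => absurd (Finset.mem_univ _) h
  · exact fun h => absurd (Finset.mem_univ _) h

/-- **THE QUARTIC WILSON CHARGE OF `w22 N` IS NOT BOND-SYMMETRIC** (`N ≠ 0`, `κ ≠ κ′`) [folklore]: at fibre directions `(κ′, κ)` the charge
at bond directions `(κ, κ′)` is `2N²` while at `(κ′, κ)` it is `0`. -/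
theorem tsum_wilsonW₂_w22_ff_not_bond_symm {N : ℕ} (hN : N ≠ 0) {κ κ' : Fin (d + 1)} (hκ : κ ≠ κ') (u : Fin (d + 1) → ℤ) :
    (∑' u' : Fin (d + 1) → ℤ, ∑' x : Fin (d + 1) → ℤ, ∑' z : Fin (d + 1) → ℤ,
        wilsonW₂ d (w22 N) κ u κ' u' x z (Sum.inl κ') (Sum.inl κ))
      ≠ ∑' u' : Fin (d + 1) → ℤ, ∑' x : Fin (d + 1) → ℤ, ∑' z : Fin (d + 1) → ℤ,
        wilsonW₂ d (w22 N) κ' u κ u' x z (Sum.inl κ') (Sum.inl κ) := by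
  rw [tsum_wilsonW₂_w22_ff_cross N hκ u, tsum_wilsonW₂_w22_ff_par N (Ne.symm hκ) u]
  have hN' : (N : ℝ) ≠ 0 := by exact_mod_cast hN
  exact mul_ne_zero (by norm_num) (pow_ne_zero 2 hN')


/-! ## §3 THE NO-GO AT `Tc := w22 Nc`: ROW W3-F2a at `m = 0` and ROW W3-F4d's `hZ0` are incompatible for `cE₂ ≠ 0` -/

section NoGo

open ExpKernelCalculus (shiftK)
open OneStepKernelFamily (KInvStep)
open StepJetData (mfNeg)
open SecondOrderResponse (LocStencilFM W2SymOfK)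
open BalabanStepJetsSucc (mmRead)
open BalabanStepW2 (K3OfK Spure M1 M2Of T2Of)
open AveragingMixedJetTables (vh₂S)
open Summit.QuantumFields.BalabanUV.Beta.HessKerDressedUnits (unitK unitS)
open Summit.QuantumFields.BalabanUV.Beta.SecondOrderUnits (unitM unitS₂ unitM₂)
open Summit.QuantumFields.BalabanUV.Beta.GAN24.CombesThomas (sfStep smStep)
open Summit.QuantumFields.BalabanUV.Beta.GAN24.BiStencilZeroMode (Tab zmode)
open Summit.QuantumFields.BalabanUV.Beta.GAN24.ChargeStepSym (quartic_charge_bond_symm_of_hZ0_of_hZb0)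

variable {Lc : ℕ} [NeZero Lc]

/-- **NO-GO FOR ROW W3-F4d's PIN HALF AT an3's COLOUR-TRACED TABLE** [our observation, kernel form of journal NOTE l.9613]: at `Tc := w22 Nc`
(`Nc ≠ 0` colours, `d ≥ 1`), for EVERY colour weight `cE₂ ≠ 0` — hence for every value of the pin — ROW W3-F2a at `m = 0` (cell form, period `Lc`:
the bracket `b 0` is field–field zero-mode-free) EXCLUDES ROW W3-F4d's `hZ0` (cell form: the first difference `T♮₁ − T♮₀` is field–field zero-mode-free).
Route: `ChargeStepSym.quartic_charge_bond_symm_of_hZ0_of_hZb0` (the two rows force a bond-symmetric quartic charge) against §2 (`w22 Nc`'s charge is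
`2Nc²` at `(0,1;1,0)` and `0` at `(1,0;1,0)`).  The END #2 ∕ ROW W3-F4d therefore needs the owner's re-cut at this table ((R1): unroll from `D₁`,
whose transported part IS zero-mode-free by `Sym ∘ Asym = 0`; or (R2): a bond-symmetric member `0`) — nothing else of road «W3» is affected. -/
theorem not_hZ0_of_hZb0_w22 (hLc : 1 ≤ Lc) (hd : 1 ≤ d) {Nc : ℕ} (hNc : Nc ≠ 0) (cE cVH cΛ cE₂ cB : ℝ) (hcE₂ : cE₂ ≠ 0)
    {mixFF : Tab d} (hmix : ∃ C δ : ℝ, 0 < δ ∧ LocStencilFM Lc mixFF C δ)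
    (hmixt : ∀ (κ : Fin (d + 1)) (u : Fin (d + 1) → ℤ) (ρ : Fin (d + 1)) (w t : Fin (d + 1) → ℤ),
      mixFF κ (u + (Lc : ℤ) • t) ρ (w + t) = shiftK (-((Lc : ℤ) • t)) (mixFF κ u ρ w))
    (hZb0 : ∀ (κ κ' α β : Fin (d + 1)), zmode Lc (fun κ u κ' u' => (cE₂ * (Lc : ℝ) ^ (2 * (d + 1))) • mmRead Lc (K3OfK
            (unitK (sfStep Lc 0) (smStep d Lc 0) (KInvStep (d := d) Lc 0)) Lc (unitS (sfStep Lc 0) (smStep d Lc 0) (Spure d Lc cE cVH cΛ 0))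
            (unitM (sfStep Lc 0) (smStep d Lc 0) (M1 d Lc cΛ 0)) (W2SymOfK (unitK (sfStep Lc 0) (smStep d Lc 0) (KInvStep (d := d) Lc 0)) Lc
            (unitS (sfStep Lc 0) (smStep d Lc 0) (Spure d Lc cE cVH cΛ 0)) (unitM (sfStep Lc 0) (smStep d Lc 0) (M1 d Lc cΛ 0)) 0
            (unitM₂ (sfStep Lc 0) (smStep d Lc 0) (M2Of d Lc mixFF 0))) κ u κ' u') + cB • mfNeg ((vh₂S d Lc) κ u κ' u'))
        κ κ' (Sum.inl α) (Sum.inl β) = 0) :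
    ¬ (∀ (κ κ' α β : Fin (d + 1)), zmode Lc (fun κ u κ' u' =>
        unitS₂ (sfStep Lc 1) (smStep d Lc 1) (T2Of d Lc cE cVH cΛ cE₂ cB (w22 Nc) (vh₂S d Lc) mixFF 1) κ u κ' u'
          - unitS₂ (sfStep Lc 0) (smStep d Lc 0) (T2Of d Lc cE cVH cΛ cE₂ cB (w22 Nc) (vh₂S d Lc) mixFF 0) κ u κ' u')
        κ κ' (Sum.inl α) (Sum.inl β) = 0) := by
  intro hZ0
  have hne : (⟨0, by omega⟩ : Fin (d + 1)) ≠ ⟨1, by omega⟩ := by simp [Fin.ext_iff]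
  have h := quartic_charge_bond_symm_of_hZ0_of_hZb0 hLc Lc cE cVH cΛ cE₂ cB (w22 Nc) hmix hmixt hZ0 hZb0
    ⟨0, by omega⟩ ⟨1, by omega⟩ ⟨1, by omega⟩ ⟨0, by omega⟩
  rw [tsum_wilsonW₂_w22_ff_cross Nc hne 0, tsum_wilsonW₂_w22_ff_par Nc hne.symm 0, sub_zero] at h
  have hL : ((Lc : ℝ)) ^ (d + 1) ≠ 0 := pow_ne_zero _ (Nat.cast_ne_zero.mpr (NeZero.ne Lc))
  have hN : (2 : ℝ) * (Nc : ℝ) ^ 2 ≠ 0 := mul_ne_zero two_ne_zero (pow_ne_zero 2 (Nat.cast_ne_zero.mpr hNc))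
  exact hN ((mul_eq_zero.1 ((mul_eq_zero.1 h).resolve_left hcE₂)).resolve_left hL)

end NoGo

end Summit.QuantumFields.BalabanUV.Beta.GAN24.WilsonQuarticChargeOffDiag

end
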